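import Summits.QuantumFields.YangMills.Theorems.FemtoCutoffLadderLocalWallTopPos

/-!
# Route `FemtoCutoffLadder`, crux `LocalWallStep` (stmt-QuantumFields-26282): the eigenfunction-free CUT bound for walled top values —
# `t(Q') ≥ (√R(f) − √(λ₀ε))²` for every physical `f` with Rayleigh quotient `R(f)` and `Q'`-bad mass fraction `ε`

Seat `leafhand-qf-femtocutoffladder-2` g0 (2026-08-30), `--supports stmt-QuantumFields-26282`.  By ✓`localWallStep_of_oneWallLowerBounds`
(p793595) the registered stub of 26282 is exactly two per-step one-wall LOWER bounds, the first being
(T) `t Q ≤ e^{A/(β²N)/L} · t (Q ∪ {p₀})`.  The parent crux's reduction (`…LargeFieldInsensitivityOfRarity`, sfw-p1 g10) controls such losses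
by cutting an exact EIGENFUNCTION (`le_sSup_rayleighSet_of_eigen_cut`: `t_P ≥ λ(1 − 2ε)`); the WALLED problems of LINE g5-A have no
eigenfunctions in the tree (their top values are suprema over hard-wall test spaces).  This file supplies the eigenfunction-free substitute:

* §1 ★ `qform_indicator_ge_sq_sub`: for physical `f` with physical cut-offs `v = 1_T f`, `w = 1_{Tᶜ} f` (`β ≥ 0`):
  `⟨v, K_β v⟩ ≥ (√⟨f,K_βf⟩ − √⟨w,K_βw⟩)²` — the triangle inequality of the `K_β`-seminorm (Cauchy–Schwarz `sq_qform_le` in the expansion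
  `qform_indicator_expand`), and `⟨w,K_βw⟩ ≤ λ₀‖w‖²`;
* §2 ★ `le_sSup_rayleighSet_of_cut` (any constraint `P` satisfied by the cut `1_T f`): if `R(f) ≥ m`, `‖1_{Tᶜ}f‖² ≤ ε‖f‖²`, `ε < 1` and
  `λ₀ε ≤ m`, then `(√m − √(λ₀ε))² ≤ t_P`;
* §3 ★ `le_walledTop_of_cut`: the wall-set instance — for EVERY wall set `Q'`, threshold `β^{κ−1}`, and every physical `f` (no admissibility
  asked of `f` itself): `(√m − √(λ₀ε))² ≤ t Q'`, `ε` = the fraction of `‖f‖²` carried by configurations with a κ-bad plaquette in `Q'`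
  (`wallCutoffs_isPhys`: the cut-offs by a wall event are physical).  For `f` admissible for `W Q` and `Q' = Q ∪ {p₀}` that fraction is the
  ONE-PLAQUETTE bad mass at `p₀` (`wall_compl_indicator_eq_of_admissible`), so (T) follows from «near-optimal walled trial states put
  fraction `≤ (1 − e^{−A/(2β²NL)})² · tQ/λ₀` of their mass on ONE more κ-bad plaquette» — the rarity statement that carries the content.
HONEST FRAMING: fixed-lattice variational bookkeeping (any `L`, `β > 0`, real `κ`); no rarity bound is proved; the `s`-half of the stub needs
the analogous two-plane statement (not here).  R2b1 is a RECORD rung — not infinite volume, not a mass gap, not Clay; no summit is proved by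
this file.  No definitions, no named facts, no `sorry`.  [cite: ReedSimonIV1978, Thm. XIII.1]
-/

set_option autoImplicit false

noncomputable section

open MeasureTheory Filter Topology Real
open Literature.MathematicalPhysics.QuantumFieldTheory hiding SU2
open Literature.MathematicalPhysics.QuantumLattice

namespace Summit.QuantumFields.YangMills.Theorems.FemtoTransferGap.SFCompression

open OffTube

variable {L : ℕ} [NeZero L]

/-! ## §1 The `K_β`-seminorm triangle inequality for a cut -/

/-- ★ **Cut lower bound without an eigen-equation**: `⟨1_Tf, K_β 1_Tf⟩ ≥ (√⟨f,K_βf⟩ − √⟨1_{Tᶜ}f, K_β 1_{Tᶜ}f⟩)²` for physical `f` with physical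
cut-offs (`β ≥ 0`; the transfer form is non-negative, so `√⟨·,K_β·⟩` is a seminorm). [cite: ReedSimonIV1978, Thm. XIII.1] -/
theorem qform_indicator_ge_sq_sub {β : ℝ} (hβ : 0 ≤ β) {T : Set (GaugeConfig 3 L SU2)} {f : GaugeConfig 3 L SU2 → ℝ}
    (hf : IsPhys f) (hw : IsPhys (Tᶜ.indicator f)) :
    (Real.sqrt (qform su2Rep β f f) - Real.sqrt (qform su2Rep β (Tᶜ.indicator f) (Tᶜ.indicator f))) ^ 2 ≤
      qform su2Rep β (T.indicator f) (T.indicator f) := by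
  set a : ℝ := qform su2Rep β f f with ha
  set b : ℝ := qform su2Rep β (Tᶜ.indicator f) (Tᶜ.indicator f) with hb
  set x : ℝ := qform su2Rep β f (Tᶜ.indicator f) with hx
  have ha0 : 0 ≤ a := qform_su2Rep_self_nonneg hβ hf
  have hb0 : 0 ≤ b := qform_su2Rep_self_nonneg hβ hw
  have hcs : x ^ 2 ≤ a * b := sq_qform_le hβ hf hw
  have hxle : x ≤ Real.sqrt a * Real.sqrt b := by
    rw [← Real.sqrt_mul ha0]
    exact Real.le_sqrt_of_sq_le hcs
  rw [qform_indicator_expand β hf hw, sub_sq, Real.sq_sqrt ha0, Real.sq_sqrt hb0]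
  linarith

/-! ## §2 The cut witness bound for a compressed top value -/

/-- ★ **`(√m − √(λ₀ε))² ≤ t_P` from ONE cut trial function.**  If `f` is physical with physical cut-offs `1_Tf`, `1_{Tᶜ}f`, the cut `1_Tf`
satisfies the constraint `P`, `R(f) ≥ m` (`m‖f‖² ≤ ⟨f,K_βf⟩`), the cut-away fraction is `‖1_{Tᶜ}f‖² ≤ ε‖f‖²` with `ε < 1`, and
`λ₀ε ≤ m`, then `(√m − √(λ₀ε))² ≤ sSup (rayleighSet su2Rep L β P)` (`β ≥ 0`). [cite: ReedSimonIV1978, Thm. XIII.1] -/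
theorem le_sSup_rayleighSet_of_cut {β : ℝ} (hβ : 0 ≤ β) {P : (GaugeConfig 3 L SU2 → ℝ) → Prop}
    {T : Set (GaugeConfig 3 L SU2)} {f : GaugeConfig 3 L SU2 → ℝ} (hf : IsPhys f) (hv : IsPhys (T.indicator f))
    (hw : IsPhys (Tᶜ.indicator f)) (hP : P (T.indicator f)) (hfpos : 0 < l2 f f) {m ε : ℝ}
    (hm : m * l2 f f ≤ qform su2Rep β f f) (hε : l2 (Tᶜ.indicator f) (Tᶜ.indicator f) ≤ ε * l2 f f) (hε1 : ε < 1)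
    (hεm : topValue su2Rep L β * ε ≤ m) :
    (Real.sqrt m - Real.sqrt (topValue su2Rep L β * ε)) ^ 2 ≤ sSup (rayleighSet su2Rep L β P) := by
  set lam0 : ℝ := topValue su2Rep L β with hlam0
  set nf : ℝ := l2 f f with hnf
  set nw : ℝ := l2 (Tᶜ.indicator f) (Tᶜ.indicator f) with hnw
  set a : ℝ := qform su2Rep β f f with ha
  set b : ℝ := qform su2Rep β (Tᶜ.indicator f) (Tᶜ.indicator f) with hb
  have hlam0pos : 0 < lam0 := topValue_su2Rep_pos L β
  have hnw0 : 0 ≤ nw := l2_self_nonneg _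
  have hε0 : 0 ≤ ε := by
    by_contra h
    have h' : ε < 0 := lt_of_not_ge h
    have : nw < 0 := lt_of_le_of_lt hε (mul_neg_of_neg_of_pos h' hfpos)
    linarith
  have hm0 : 0 ≤ m := le_trans (mul_nonneg hlam0pos.le hε0) hεm
  have ha0 : 0 ≤ a := qform_su2Rep_self_nonneg hβ hf
  have hb0 : 0 ≤ b := qform_su2Rep_self_nonneg hβ hw
  -- `b ≤ λ₀ ‖w‖² ≤ λ₀ ε ‖f‖² ≤ m ‖f‖² ≤ a`
  have hb1 : b ≤ lam0 * ε * nf := by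
    calc b ≤ lam0 * nw := qform_le_topValue_mul_l2 hβ hw
      _ ≤ lam0 * (ε * nf) := mul_le_mul_of_nonneg_left hε hlam0pos.le
      _ = lam0 * ε * nf := by ring
  have hma : m * nf ≤ a := hm
  -- the seminorm triangle inequality, then monotonicity in both slots
  have htri := qform_indicator_ge_sq_sub hβ (T := T) hf hw
  have hsa : Real.sqrt (m * nf) ≤ Real.sqrt a := Real.sqrt_le_sqrt hma
  have hsb : Real.sqrt b ≤ Real.sqrt (lam0 * ε * nf) := Real.sqrt_le_sqrt hb1
  have hord : Real.sqrt (lam0 * ε * nf) ≤ Real.sqrt (m * nf) :=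
    Real.sqrt_le_sqrt (by nlinarith [hfpos.le])
  have hkey : (Real.sqrt (m * nf) - Real.sqrt (lam0 * ε * nf)) ^ 2 ≤ (Real.sqrt a - Real.sqrt b) ^ 2 := by
    have h1 : 0 ≤ Real.sqrt (m * nf) - Real.sqrt (lam0 * ε * nf) := sub_nonneg.mpr hord
    have h2 : Real.sqrt (m * nf) - Real.sqrt (lam0 * ε * nf) ≤ Real.sqrt a - Real.sqrt b := by linarith
    exact pow_le_pow_left₀ h1 h2 2
  -- factor out `‖f‖²`
  have hfac : (Real.sqrt (m * nf) - Real.sqrt (lam0 * ε * nf)) ^ 2 = nf * (Real.sqrt m - Real.sqrt (lam0 * ε)) ^ 2 := by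
    rw [Real.sqrt_mul' m hfpos.le, show lam0 * ε * nf = (lam0 * ε) * nf by ring,
      Real.sqrt_mul' (lam0 * ε) hfpos.le, ← sub_mul, mul_pow, Real.sq_sqrt hfpos.le]
    ring
  -- the cut has positive norm and norm at most `‖f‖²`
  have hnv : l2 (T.indicator f) (T.indicator f) = nf - nw := l2_indicator_self_eq hv hw
  have hnvpos : 0 < l2 (T.indicator f) (T.indicator f) := by
    rw [hnv]
    have : nw ≤ ε * nf := hε
    nlinarith
  have hnvle : l2 (T.indicator f) (T.indicator f) ≤ nf := by rw [hnv]; linarith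
  refine le_sSup_rayleighSet_of_witness β hv hP hnvpos ?_
  calc (Real.sqrt m - Real.sqrt (lam0 * ε)) ^ 2 * l2 (T.indicator f) (T.indicator f)
      ≤ (Real.sqrt m - Real.sqrt (lam0 * ε)) ^ 2 * nf := mul_le_mul_of_nonneg_left hnvle (sq_nonneg _)
    _ = (Real.sqrt (m * nf) - Real.sqrt (lam0 * ε * nf)) ^ 2 := by rw [hfac]; ring
    _ ≤ (Real.sqrt a - Real.sqrt b) ^ 2 := hkey
    _ ≤ qform su2Rep β (T.indicator f) (T.indicator f) := htri

/-! ## §3 The wall-set instance -/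

/-- The event «some plaquette of the wall set `Q` is bad at threshold `c`» is measurable. [folklore] -/
theorem measurableSet_wallBad (c : ℝ) (Q : Set (Plaquette 3 L)) :
    MeasurableSet {U : GaugeConfig 3 L SU2 | ∃ p ∈ Q, c < 2 - (su2Rep (plaquetteHolonomy U p.1 p.2.1.1 p.2.1.2)).trace.re} := by
  classical
  have h : {U : GaugeConfig 3 L SU2 | ∃ p ∈ Q, c < 2 - (su2Rep (plaquetteHolonomy U p.1 p.2.1.1 p.2.1.2)).trace.re}
      = ⋃ p : Plaquette 3 L, {U | p ∈ Q ∧ c < 2 - (su2Rep (plaquetteHolonomy U p.1 p.2.1.1 p.2.1.2)).trace.re} := by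
    ext U; simp only [Set.mem_setOf_eq, Set.mem_iUnion]
  rw [h]
  refine MeasurableSet.iUnion fun p => ?_
  by_cases hp : p ∈ Q
  · have : {U : GaugeConfig 3 L SU2 | p ∈ Q ∧ c < 2 - (su2Rep (plaquetteHolonomy U p.1 p.2.1.1 p.2.1.2)).trace.re}
        = {U | c < 2 - (su2Rep (plaquetteHolonomy U p.1 p.2.1.1 p.2.1.2)).trace.re} := by
      ext U; simp only [Set.mem_setOf_eq, hp, true_and]
    rw [this]
    exact measurableSet_lt measurable_const (continuous_plaquetteDeviation p).measurable
  · have : {U : GaugeConfig 3 L SU2 | p ∈ Q ∧ c < 2 - (su2Rep (plaquetteHolonomy U p.1 p.2.1.1 p.2.1.2)).trace.re} = ∅ := by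
      ext U; simp only [Set.mem_setOf_eq, hp, false_and, Set.mem_empty_iff_false]
    rw [this]
    exact MeasurableSet.empty

/-- **Wall cut-offs are physical**: for the wall event `∃ p ∈ Q, c < 2 − Re tr U_p` the good and bad cut-offs of a physical test function are
physical (measurable event, conjugation-invariant traces, central twists fix plaquette holonomies). [cite: tHooft1979] -/
theorem wallCutoffs_isPhys (c : ℝ) (Q : Set (Plaquette 3 L)) {f : GaugeConfig 3 L SU2 → ℝ} (hf : IsPhys f) :
    IsPhys ({U : GaugeConfig 3 L SU2 | ¬ ∃ p ∈ Q,
        c < 2 - (su2Rep (plaquetteHolonomy U p.1 p.2.1.1 p.2.1.2)).trace.re}.indicator f) ∧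
      IsPhys ({U : GaugeConfig 3 L SU2 | ¬ ∃ p ∈ Q,
        c < 2 - (su2Rep (plaquetteHolonomy U p.1 p.2.1.1 p.2.1.2)).trace.re}ᶜ.indicator f) := by
  refine cutoffs_isPhys_of_invariant (measurableSet_wallBad c Q) ?_ ?_ hf
  · intro g U
    refine exists_congr fun p => and_congr_right fun _ => ?_
    rw [Literature.MathematicalPhysics.QuantumLattice.plaquetteHolonomy_gaugeTransform, trace_su2Rep_conj]
  · intro k z hz U
    refine exists_congr fun p => and_congr_right fun _ => ?_
    rw [plaquetteHolonomy_twist_of_mem_center k hz U p.1 (ne_of_lt p.2.2)]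

omit [NeZero L] in
/-- For `f` admissible for the wall set `Q` (vanishing wherever a plaquette of `Q` is bad), the part of `f` cut away by the larger wall set
`Q ∪ {p₀}` is exactly its restriction to «`p₀` is bad»: the ONE-PLAQUETTE bad piece. [folklore] -/
theorem wall_compl_indicator_eq_of_admissible (c : ℝ) (Q : Set (Plaquette 3 L)) (p₀ : Plaquette 3 L)
    {f : GaugeConfig 3 L SU2 → ℝ}
    (hfQ : ∀ U : GaugeConfig 3 L SU2,
      (∃ p ∈ Q, c < 2 - (su2Rep (plaquetteHolonomy U p.1 p.2.1.1 p.2.1.2)).trace.re) → f U = 0) :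
    {U : GaugeConfig 3 L SU2 | ¬ ∃ p ∈ insert p₀ Q,
        c < 2 - (su2Rep (plaquetteHolonomy U p.1 p.2.1.1 p.2.1.2)).trace.re}ᶜ.indicator f =
      {U : GaugeConfig 3 L SU2 | c < 2 - (su2Rep (plaquetteHolonomy U p₀.1 p₀.2.1.1 p₀.2.1.2)).trace.re}.indicator f := by
  classical
  set S : Set (GaugeConfig 3 L SU2) := {U : GaugeConfig 3 L SU2 | ¬ ∃ p ∈ insert p₀ Q,
    c < 2 - (su2Rep (plaquetteHolonomy U p.1 p.2.1.1 p.2.1.2)).trace.re} with hS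
  set B : Set (GaugeConfig 3 L SU2) := {U : GaugeConfig 3 L SU2 |
    c < 2 - (su2Rep (plaquetteHolonomy U p₀.1 p₀.2.1.1 p₀.2.1.2)).trace.re} with hB
  funext U
  by_cases h0 : c < 2 - (su2Rep (plaquetteHolonomy U p₀.1 p₀.2.1.1 p₀.2.1.2)).trace.re
  · have hmem : U ∈ Sᶜ := by
      rw [Set.mem_compl_iff, hS, Set.mem_setOf_eq, not_not]
      exact ⟨p₀, Set.mem_insert p₀ Q, h0⟩
    have hmem' : U ∈ B := by rw [hB, Set.mem_setOf_eq]; exact h0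
    rw [Set.indicator_of_mem hmem, Set.indicator_of_mem hmem']
  · have hnot' : U ∉ B := by rw [hB, Set.mem_setOf_eq]; exact h0
    rw [Set.indicator_of_notMem hnot']
    by_cases hU : U ∈ Sᶜ
    · rw [Set.indicator_of_mem hU]
      have hex : ∃ p ∈ Q, c < 2 - (su2Rep (plaquetteHolonomy U p.1 p.2.1.1 p.2.1.2)).trace.re := by
        rw [Set.mem_compl_iff, hS, Set.mem_setOf_eq, not_not] at hU
        obtain ⟨p, hp, hc⟩ := hU
        rcases Set.mem_insert_iff.mp hp with rfl | hpQ
        · exact absurd hc h0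
        · exact ⟨p, hpQ, hc⟩
      exact hfQ U hex
    · rw [Set.indicator_of_notMem hU]

/-- ★ **The walled cut bound.**  For `β > 0`, any real `κ`, ANY wall set `Q'` and ANY physical `f` with `0 < ‖f‖²`, Rayleigh quotient
`≥ m` and fraction `≤ ε < 1` of `‖f‖²` on «some plaquette of `Q'` is κ-bad», with `λ₀ε ≤ m`:
`(√m − √(λ₀ε))² ≤ t Q' = sSup (rayleighSet su2Rep L β (W Q'))` — the cut `1_{Q'-good} f` is the witness.  With `Q' = Q ∪ {p₀}` and `f`
admissible for `W Q`, `ε` is the one-plaquette bad mass at `p₀` (`wall_compl_indicator_eq_of_admissible`). [cite: ReedSimonIV1978, Thm. XIII.1] -/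
theorem le_walledTop_of_cut {β : ℝ} (hβ : 0 < β) (κ : ℝ) (Q' : Set (Plaquette 3 L)) {f : GaugeConfig 3 L SU2 → ℝ}
    (hf : IsPhys f) (hfpos : 0 < l2 f f) {m ε : ℝ} (hm : m * l2 f f ≤ qform su2Rep β f f)
    (hε : l2 ({U : GaugeConfig 3 L SU2 | ¬ ∃ p ∈ Q',
        β ^ (κ - 1) < 2 - (su2Rep (plaquetteHolonomy U p.1 p.2.1.1 p.2.1.2)).trace.re}ᶜ.indicator f)
      ({U : GaugeConfig 3 L SU2 | ¬ ∃ p ∈ Q',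
        β ^ (κ - 1) < 2 - (su2Rep (plaquetteHolonomy U p.1 p.2.1.1 p.2.1.2)).trace.re}ᶜ.indicator f) ≤ ε * l2 f f)
    (hε1 : ε < 1) (hεm : topValue su2Rep L β * ε ≤ m) :
    (Real.sqrt m - Real.sqrt (topValue su2Rep L β * ε)) ^ 2 ≤
      sSup (rayleighSet su2Rep L β fun ψ => ∀ U : GaugeConfig 3 L SU2,
        (∃ p ∈ Q', β ^ (κ - 1) < 2 - (su2Rep (plaquetteHolonomy U p.1 p.2.1.1 p.2.1.2)).trace.re) → ψ U = 0) := by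
  obtain ⟨hv, hw⟩ := wallCutoffs_isPhys (β ^ (κ - 1)) Q' hf
  refine le_sSup_rayleighSet_of_cut hβ.le hf hv hw ?_ hfpos hm hε hε1 hεm
  intro U hU
  exact Set.indicator_of_notMem (fun h : U ∈ {U : GaugeConfig 3 L SU2 | ¬ ∃ p ∈ Q',
    β ^ (κ - 1) < 2 - (su2Rep (plaquetteHolonomy U p.1 p.2.1.1 p.2.1.2)).trace.re} => h hU) _

end Summit.QuantumFields.YangMills.Theorems.FemtoTransferGap.SFCompression

end
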